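import Summits.MatrixMultiplication.MatrixMultiplication.Theorems.SoloInformedGammaDoor

/-!
# Unconditional doors for all block-normal carriers with a monomial or zero-corner `c₀`-block

Solo deliverable (informed mode), extending `SoloInformedGammaDoor` (`T_{1,1,Γ₂} ⊵ T_{skewcw,2}`,
asymptotic rank is degeneration-monotone) from class representatives to explicit open families of
blocks, with no classification of congruence classes and no hypothesis:

* `laserBound_antiDiag` / `laserBound_diag`: the weighted laser engine of
  `SoloInformedWeightedLaser` applies verbatim to `T_{1,1,M}` whenever the inner block `M′` is a
  MONOMIAL matrix (anti-diagonal `[[0,α],[β,0]]` or diagonal `diag(α,β)`, `αβ ≠ 0`): base-2 value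
  bound `R̃ < ρ ⇒ ω ≤ log₂(4ρ³/27)`.
* `isApproxRestriction_killLower` / `isApproxRestriction_killUpper`: the toric degenerations
  `A = B = diag(1,1,ε)`, `C = diag(1,ε,1)` (resp. `A = B = diag(1,ε,1)`, `C = diag(1,1,ε)`) delete
  the `(2,2)` (resp. `(1,1)`) entry of the `c₀`-block when the opposite corner vanishes, keeping
  everything else: `T_{1,1,[[0,α],[β,γ]]} ⊵ T_{1,1,[[0,α],[β,0]]}`.
* `matrixMultiplication_of_cornerBlock_door`: hence for EVERY `M` with `M′₁₂ M′₂₁ ≠ 0` and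
  `M′₁₁ = 0 ∨ M′₂₂ = 0` (this contains the skew block `J`, all `H(μ)`, `Γ₂` and their non-normalised
  versions) and for every monomial `M′`, `R̃(T_{1,1,M}) ≤ 3 ⇒ ω = 2` is an unconditional theorem.
  The only block-normal carriers whose door still rests on the named fact `hBCS` in the kernel are
  those with `M′₁₁ M′₂₂ ≠ 0` and `(M′₁₂, M′₂₁) ≠ (0,0)`.
-/

noncomputable section

open scoped BigOperators Polynomial
open Polynomial
open Literature.Computability.AlgebraicComplexity

namespace Summit.MatrixMultiplication.MatrixMultiplication.Theorems.CarrierFamily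

/-! ## The weighted engine on monomial blocks -/

/-- `T_{1,1,M} ≠ 0` (the entry `a₀ b₁ c₁`). [folklore] -/
theorem cwShapeTensor_one_one_ne_zero (M : Matrix (Fin 3) (Fin 3) ℂ) : cwShapeTensor 1 1 M ≠ 0 := by
  intro h
  have e := congrFun (congrFun (congrFun h 0) 1) 1
  simp [cwShapeTensor] at e

/-- The support of `T_{1,1,M}` has Coppersmith–Winograd block shape. [folklore] -/
theorem cwShapeTensor_support (P Q M : Matrix (Fin 3) (Fin 3) ℂ) (i j k : Fin 3)
    (h : cwShapeTensor P Q M i j k ≠ 0) :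
    (i = 0 ∧ j ≠ 0 ∧ k ≠ 0) ∨ (j = 0 ∧ i ≠ 0 ∧ k ≠ 0) ∨ (k = 0 ∧ i ≠ 0 ∧ j ≠ 0) := by
  simp only [cwShapeTensor] at h
  split_ifs at h with h1 h2 h3
  · exact Or.inl h1
  · exact Or.inr (Or.inl h2)
  · exact Or.inr (Or.inr h3)
  · exact absurd rfl h

/-- **Value bound for an anti-diagonal `c₀`-block** `M′ = [[0,α],[β,0]]`, `αβ ≠ 0`:
`R̃(T_{1,1,M}) < ρ ⇒ ω ≤ log₂(4ρ³/27)` (weighted laser engine, `σ₃ = (1 2)`, weights `(α, β)`).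
[cite: BurgisserClausenShokrollahi1997, Thm. (15.41), Ex. 15.24(7)] -/
theorem laserBound_antiDiag {M : Matrix (Fin 3) (Fin 3) ℂ} (h11 : M 1 1 = 0) (h22 : M 2 2 = 0)
    (h12 : M 1 2 ≠ 0) (h21 : M 2 1 ≠ 0) (ρ : ℝ) (hρ : asymptoticRank (cwShapeTensor 1 1 M) < ρ) :
    omega ℂ ≤ Real.logb 2 (4 * ρ ^ 3 / 27) := by
  have h := WeightedLaser.omega_le_logb_of_asymptoticRank_weightedCw_lt 2 le_rfl
    (cwShapeTensor 1 1 M) (cwShapeTensor_one_one_ne_zero M) id id ![1, 0] (fun _ _ h => h)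
    (fun _ _ h => h) (by decide) (fun _ => 1) (fun _ => 1) ![M 1 2, M 2 1]
    (fun _ => one_ne_zero) (fun _ => one_ne_zero) (fun x => by fin_cases x <;> simp [h12, h21])
    ?_ ?_ ?_ (cwShapeTensor_support 1 1 M) hρ
  · simpa using h
  · intro x y; fin_cases x <;> fin_cases y <;> simp [cwShapeTensor]
  · intro x y; fin_cases x <;> fin_cases y <;> simp [cwShapeTensor]
  · intro x y; fin_cases x <;> fin_cases y <;> simp [cwShapeTensor, h11, h22]

/-- **Value bound for a diagonal `c₀`-block** `M′ = diag(α, β)`, `αβ ≠ 0` (weighted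
Coppersmith–Winograd tensors): `R̃(T_{1,1,M}) < ρ ⇒ ω ≤ log₂(4ρ³/27)`.
[cite: BurgisserClausenShokrollahi1997, Thm. (15.41), Ex. 15.24(7)] -/
theorem laserBound_diag {M : Matrix (Fin 3) (Fin 3) ℂ} (h12 : M 1 2 = 0) (h21 : M 2 1 = 0)
    (h11 : M 1 1 ≠ 0) (h22 : M 2 2 ≠ 0) (ρ : ℝ) (hρ : asymptoticRank (cwShapeTensor 1 1 M) < ρ) :
    omega ℂ ≤ Real.logb 2 (4 * ρ ^ 3 / 27) := by
  have h := WeightedLaser.omega_le_logb_of_asymptoticRank_weightedCw_lt 2 le_rfl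
    (cwShapeTensor 1 1 M) (cwShapeTensor_one_one_ne_zero M) id id id (fun _ _ h => h)
    (fun _ _ h => h) (fun _ _ h => h) (fun _ => 1) (fun _ => 1) ![M 1 1, M 2 2]
    (fun _ => one_ne_zero) (fun _ => one_ne_zero) (fun x => by fin_cases x <;> simp [h11, h22])
    ?_ ?_ ?_ (cwShapeTensor_support 1 1 M) hρ
  · simpa using h
  · intro x y; fin_cases x <;> fin_cases y <;> simp [cwShapeTensor]
  · intro x y; fin_cases x <;> fin_cases y <;> simp [cwShapeTensor]
  · intro x y; fin_cases x <;> fin_cases y <;> simp [cwShapeTensor, h12, h21]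

/-! ## Toric deletion of a diagonal corner of the `c₀`-block -/

/-- `M` with its `(2,2)` entry deleted. [folklore] -/
def killLower (M : Matrix (Fin 3) (Fin 3) ℂ) : Matrix (Fin 3) (Fin 3) ℂ := fun i j =>
  if i = 2 ∧ j = 2 then 0 else M i j

/-- `M` with its `(1,1)` entry deleted. [folklore] -/
def killUpper (M : Matrix (Fin 3) (Fin 3) ℂ) : Matrix (Fin 3) (Fin 3) ℂ := fun i j =>
  if i = 1 ∧ j = 1 then 0 else M i j

/-- `C(ε) = diag(1, ε, 1)`. [folklore] -/
def lowerDegC : Fin 3 → Fin 3 → ℂ[X] := fun c' c =>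
  if c = c' then monomial (![0, 1, 0] c') 1 else 0

/-- `A(ε) = B(ε) = diag(1, ε, 1)`. [folklore] -/
def upperDegA : Fin 3 → Fin 3 → ℂ[X] := fun a' a =>
  if a = a' then monomial (![0, 1, 0] a') 1 else 0

/-- `C(ε) = diag(1, 1, ε)`. [folklore] -/
def upperDegC : Fin 3 → Fin 3 → ℂ[X] := fun c' c =>
  if c = c' then monomial (![0, 0, 1] c') 1 else 0

/-- **`(diag(1,1,ε), diag(1,1,ε), diag(1,ε,1)) · T_{1,1,M} = ε · T_{1,1,killLower M} + O(ε²)`** when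
`M′₁₁ = 0` (the `(2,2)` term is the only one of degree `2`). [folklore] -/
theorem isApproxRestriction_killLower (M : Matrix (Fin 3) (Fin 3) ℂ) (h11 : M 1 1 = 0) :
    IsApproxRestriction 1 (cwShapeTensor 1 1 M) (cwShapeTensor 1 1 (killLower M))
      gammaDegA gammaDegA lowerDegC := by
  intro a' b' c' j hj
  interval_cases j <;> fin_cases a' <;> fin_cases b' <;> fin_cases c' <;>
    simp [gammaDegA, lowerDegC, cwShapeTensor, killLower, h11, Matrix.one_apply,
      Polynomial.coeff_monomial, Polynomial.monomial_mul_monomial]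

/-- **`(diag(1,ε,1), diag(1,ε,1), diag(1,1,ε)) · T_{1,1,M} = ε · T_{1,1,killUpper M} + O(ε²)`** when
`M′₂₂ = 0`. [folklore] -/
theorem isApproxRestriction_killUpper (M : Matrix (Fin 3) (Fin 3) ℂ) (h22 : M 2 2 = 0) :
    IsApproxRestriction 1 (cwShapeTensor 1 1 M) (cwShapeTensor 1 1 (killUpper M))
      upperDegA upperDegA upperDegC := by
  intro a' b' c' j hj
  interval_cases j <;> fin_cases a' <;> fin_cases b' <;> fin_cases c' <;>
    simp [upperDegA, upperDegC, cwShapeTensor, killUpper, h22, Matrix.one_apply,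
      Polynomial.coeff_monomial, Polynomial.monomial_mul_monomial]

/-- `R̃(T_{1,1,killLower M}) ≤ R̃(T_{1,1,M})` when `M′₁₁ = 0`. [folklore] -/
theorem asymptoticRank_killLower_le (M : Matrix (Fin 3) (Fin 3) ℂ) (h11 : M 1 1 = 0) :
    asymptoticRank (cwShapeTensor 1 1 (killLower M)) ≤ asymptoticRank (cwShapeTensor 1 1 M) :=
  asymptoticRank_le_of_algDegeneratesTo ⟨1, _, _, _, isApproxRestriction_killLower M h11⟩

/-- `R̃(T_{1,1,killUpper M}) ≤ R̃(T_{1,1,M})` when `M′₂₂ = 0`. [folklore] -/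
theorem asymptoticRank_killUpper_le (M : Matrix (Fin 3) (Fin 3) ℂ) (h22 : M 2 2 = 0) :
    asymptoticRank (cwShapeTensor 1 1 (killUpper M)) ≤ asymptoticRank (cwShapeTensor 1 1 M) :=
  asymptoticRank_le_of_algDegeneratesTo ⟨1, _, _, _, isApproxRestriction_killUpper M h22⟩

/-! ## The doors -/

/-- **Value bound for every zero-corner block**: `M′₁₂ M′₂₁ ≠ 0` and `M′₁₁ = 0 ∨ M′₂₂ = 0` ⇒
(`R̃(T_{1,1,M}) < ρ ⇒ ω ≤ log₂(4ρ³/27)`), unconditionally (degenerate to the anti-diagonal block,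
then the weighted engine). [cite: BurgisserClausenShokrollahi1997, Thm. (15.41), Ex. 15.24(7)] -/
theorem laserBound_cornerBlock {M : Matrix (Fin 3) (Fin 3) ℂ} (h12 : M 1 2 ≠ 0) (h21 : M 2 1 ≠ 0)
    (hcorner : M 1 1 = 0 ∨ M 2 2 = 0) (ρ : ℝ) (hρ : asymptoticRank (cwShapeTensor 1 1 M) < ρ) :
    omega ℂ ≤ Real.logb 2 (4 * ρ ^ 3 / 27) := by
  rcases hcorner with h11 | h22
  · exact laserBound_antiDiag (M := killLower M) (by simp [killLower, h11]) (by simp [killLower])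
      (by simpa [killLower] using h12) (by simpa [killLower] using h21) ρ
      ((asymptoticRank_killLower_le M h11).trans_lt hρ)
  · exact laserBound_antiDiag (M := killUpper M) (by simp [killUpper]) (by simp [killUpper, h22])
      (by simpa [killUpper] using h12) (by simpa [killUpper] using h21) ρ
      ((asymptoticRank_killUpper_le M h22).trans_lt hρ)

/-- **The door for every zero-corner block, unconditionally**: `M′₁₂ M′₂₁ ≠ 0`,
`M′₁₁ = 0 ∨ M′₂₂ = 0`, `R̃(T_{1,1,M}) ≤ 3 ⇒ ω = 2`. Contains the skew door (`M′ = J`), every `H(μ)`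
and `Γ₂`.
[cite: ConnerGesmundoLandsbergVentura2022, §5] -/
theorem matrixMultiplication_of_cornerBlock_door {M : Matrix (Fin 3) (Fin 3) ℂ} (h12 : M 1 2 ≠ 0)
    (h21 : M 2 1 ≠ 0) (hcorner : M 1 1 = 0 ∨ M 2 2 = 0)
    (h : asymptoticRank (cwShapeTensor 1 1 M) ≤ 3) : _root_.MatrixMultiplication :=
  matrixMultiplication_of_laserBound (laserBound_cornerBlock h12 h21 hcorner) h

/-- **The door for every monomial block, unconditionally** (diagonal: weighted Coppersmith–Winograd;
anti-diagonal: weighted skew/`H(μ)`): `R̃(T_{1,1,M}) ≤ 3 ⇒ ω = 2`.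
[cite: CoppersmithWinograd1990, §6] -/
theorem matrixMultiplication_of_monomialBlock_door {M : Matrix (Fin 3) (Fin 3) ℂ}
    (hM : (M 1 2 = 0 ∧ M 2 1 = 0 ∧ M 1 1 ≠ 0 ∧ M 2 2 ≠ 0) ∨
      (M 1 1 = 0 ∧ M 2 2 = 0 ∧ M 1 2 ≠ 0 ∧ M 2 1 ≠ 0))
    (h : asymptoticRank (cwShapeTensor 1 1 M) ≤ 3) : _root_.MatrixMultiplication := by
  rcases hM with ⟨h12, h21, h11, h22⟩ | ⟨h11, h22, h12, h21⟩
  · exact matrixMultiplication_of_laserBound (laserBound_diag h12 h21 h11 h22) h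
  · exact matrixMultiplication_of_laserBound (laserBound_antiDiag h11 h22 h12 h21) h

/-- Width, uniformly: for every zero-corner block, `R̃(T_{1,1,M}) ≤ 3.25 ⇒ ω < 2.37`.
[cite: AlmanDuanVassilevskaWilliamsXuXuZhou2025, Theorem 1.1] -/
theorem omega_lt_of_asymptoticRank_cornerBlock_le {M : Matrix (Fin 3) (Fin 3) ℂ} (h12 : M 1 2 ≠ 0)
    (h21 : M 2 1 ≠ 0) (hcorner : M 1 1 = 0 ∨ M 2 2 = 0)
    (h : asymptoticRank (cwShapeTensor 1 1 M) ≤ 3.25) : omega ℂ < 2.37 := by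
  have hρ : asymptoticRank (cwShapeTensor 1 1 M) < 3.26 := lt_of_le_of_lt h (by norm_num)
  exact (laserBound_cornerBlock h12 h21 hcorner _ hρ).trans_lt WeightedLaser.logb_two_laser_bound_lt

end Summit.MatrixMultiplication.MatrixMultiplication.Theorems.CarrierFamily

end
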